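import Summits.RiemannHypothesis.RiemannHypothesis.Theorems.SuzukiSharpRadius

/-!
# SuzukiSharpRadiusEight — an UNCONDITIONAL line: the minimum of `Re ξ'/ξ` on `Re s = 8` is at the real point, hence
every `c < (2/15)·ξ'/ξ(8) ≈ 0.04275` is a linear clean radius of Suzuki's single operator (column DBR; RH-FREE)

RH-FREE throughout; nothing here bears on the truth of RH.  Third proof file of the cell rh-dbr's target T-LCR⋆.
The sharp constant `c⋆ = 2ξ'/ξ(1) = 0.04619…` needs the one-line minimum S2 near `σ = 1` (zero information, not in the
tree).  On the line `σ = 8` NO zero information is needed: from the explicit formula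
`ξ'/ξ(s) = 1/s + 1/(s−1) − ½log π + ½ψ(s/2) − Σ Λ(n)n^{-s}` (`logDeriv_riemannXi_eq_of_one_lt_re`), for `s = 8 + iu`,
* `Re Σ Λ(n) n^{-s} ≤ Σ Λ(n) n^{-8}` (termwise), and
* Gauss' series (`hasSum_one_div_sub_one_div_digamma`) gives
  `½(Re ψ(4 + iu/2) − ψ(4)) = Σ_{k≥0} u²/((8+2k)((8+2k)²+u²)) ≥ [1/8 − Re 1/s] + [1/7 − Re 1/(s−1)]`
  (the `k = 0` term IS the first bracket; the terms `1 ≤ k ≤ 18` dominate the second since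
  `Σ_{k=1}^{18} 7³/(8+2k)³ ≥ 1` and `(8+2k)² ≥ 49`),
so `Re ξ'/ξ(8+iu) ≥ ξ'/ξ(8)` for every real `u` (`xiLogDerivRe_eight_min`).  With the window mechanism of
`Theorems.SuzukiSharpRadius` (§2 there, line `b = σ − ½ = 15/2`): **every `c < (2/15)·ξ'/ξ(8)` is a linear clean radius**
(`linear_clean_radius_eight`), unconditionally — `ξ'/ξ(8) = 15/56 + 11/12 − γ/2 − ½log π − ΣΛ(n)n⁻⁸ = 0.32066…`, i.e.
`c < 0.042755…` (numerical value; a certified enclosure is filed separately), about `600×` the landed constant of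
`Theorems.SuzukiCleanRadius` and `92.5 %` of `c⋆`.

References: [Su20] M. Suzuki, ASPM 84 (2020) = arXiv:1907.07302, (1.9); Andrews–Askey–Roy, *Special Functions*, Thm 1.2.5
(Gauss' series for `ψ`); E. Bombieri, *Remarks on Weil's quadratic functional* (2000), §2 (the explicit formula for `ξ'/ξ`).
-/

noncomputable section

-- D-0017: `Summit.<S>.<S>.…` is the designed namespace of a single-problem summit.
set_option linter.dupNamespace false

open Complex Filter Topology Set LSeries

open scoped LSeries.notation ArithmeticFunction.vonMangoldt

namespace Summit.RiemannHypothesis.RiemannHypothesis.Theorems.SuzukiSharpRadius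

open Literature.NumberTheory.LFunctions Literature.Analysis.SpecialFunctions.Complex
open Summit.RiemannHypothesis.RiemannHypothesis.Theorems.SuzukiCleanRadius

/-! ## §1 The Dirichlet-series part: `Re Σ Λ(n) n^{-s} ≤ Σ Λ(n) n^{-σ}` on `Re s = σ` -/

/-- For real `σ` the von Mangoldt term `Λ(n) n^{-σ}` is the real number `Λ(n)/n^σ ≥ 0`. -/
theorem term_vonMangoldt_ofReal (σ : ℝ) (n : ℕ) :
    term ↗Λ (σ : ℂ) n = ((if n = 0 then (0 : ℝ) else Λ n / (n : ℝ) ^ σ : ℝ) : ℂ) := by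
  rcases eq_or_ne n 0 with rfl | hn
  · simp
  · rw [term_of_ne_zero hn, if_neg hn, Complex.ofReal_div, ← Complex.ofReal_natCast,
      ← Complex.ofReal_cpow (Nat.cast_nonneg n)]

/-- On the line `Re s = σ > 1`: `Re Σ Λ(n) n^{-s} ≤ Σ Λ(n) n^{-σ} = Re Σ Λ(n) n^{-σ}` (termwise `Re z ≤ |z|`). -/
theorem re_LSeries_vonMangoldt_le {σ : ℝ} (hσ : 1 < σ) {s : ℂ} (hs : s.re = σ) :
    (L ↗Λ s).re ≤ (L ↗Λ (σ : ℂ)).re := by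
  have hs1 : 1 < s.re := by rw [hs]; exact hσ
  have hσ1 : 1 < ((σ : ℂ)).re := by simpa using hσ
  have h1 := Complex.hasSum_re (ArithmeticFunction.LSeriesSummable_vonMangoldt hs1).hasSum
  have h2 := Complex.hasSum_re (ArithmeticFunction.LSeriesSummable_vonMangoldt hσ1).hasSum
  refine hasSum_le (fun n => ?_) h1 h2
  have hreal : (term ↗Λ (σ : ℂ) n).re = ‖term ↗Λ (σ : ℂ) n‖ := by
    rw [term_vonMangoldt_ofReal, Complex.ofReal_re, Complex.norm_real, Real.norm_eq_abs, abs_of_nonneg]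
    split_ifs
    · exact le_rfl
    · exact div_nonneg ArithmeticFunction.vonMangoldt_nonneg (by positivity)
  calc (term ↗Λ s n).re ≤ ‖term ↗Λ s n‖ := Complex.re_le_norm _
    _ ≤ ‖term ↗Λ (σ : ℂ) n‖ := norm_term_le_of_re_le_re _ (by simp [hs]) n
    _ = (term ↗Λ (σ : ℂ) n).re := hreal.symm

/-! ## §2 The digamma part: Gauss' series on the line `Re w = 4` -/

/-- Gauss' series, differenced: `Re ψ(4 + iu/2) − Re ψ(4) = Σ_{k≥0} u²/((4+k)((8+2k)² + u²))`. -/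
theorem hasSum_re_digamma_four_line (u : ℝ) :
    HasSum (fun k : ℕ => u ^ 2 / ((4 + k) * ((8 + 2 * k) ^ 2 + u ^ 2)))
      ((digamma (4 + ((u / 2 : ℝ) : ℂ) * I)).re - (digamma (4 : ℂ)).re) := by
  set w : ℂ := 4 + ((u / 2 : ℝ) : ℂ) * I with hw
  have hwre : w.re = 4 := by simp [hw]
  have hwim : w.im = u / 2 := by simp [hw]
  have hw0 : 0 < w.re := by rw [hwre]; norm_num
  have h40 : 0 < ((4 : ℂ)).re := by norm_num
  have h1 := Complex.hasSum_re (hasSum_one_div_sub_one_div_digamma hw0)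
  have h2 := Complex.hasSum_re (hasSum_one_div_sub_one_div_digamma h40)
  simp only [Complex.add_re, Complex.ofReal_re] at h1 h2
  have h := h1.sub h2
  have hv : (digamma w).re + Real.eulerMascheroniConstant - ((digamma (4 : ℂ)).re + Real.eulerMascheroniConstant) =
      (digamma w).re - (digamma (4 : ℂ)).re := by ring
  rw [hv] at h
  refine h.congr_fun fun k => ?_
  have e1 : (1 / ((4 : ℂ) + (k : ℂ))).re = 1 / (4 + k) := by
    have := re_one_div_add_ofReal (4 : ℂ) (k : ℝ)
    simp only [Complex.ofReal_natCast] at this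
    rw [this]
    have hk : (0 : ℝ) < 4 + k := by positivity
    norm_num
    field_simp
  have e2 : (1 / (w + (k : ℂ))).re = (4 + k) / ((4 + k) ^ 2 + (u / 2) ^ 2) := by
    have := re_one_div_add_ofReal w (k : ℝ)
    simp only [Complex.ofReal_natCast] at this
    rw [this, hwre, hwim]
  rw [Complex.sub_re, Complex.sub_re, e1, e2]
  have hk : (0 : ℝ) < 4 + k := by positivity
  have hk2 : (0 : ℝ) < (4 + k) ^ 2 + (u / 2) ^ 2 := by positivity
  field_simp
  ring

/-- The `k`-th Gauss term is nonnegative. -/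
theorem gaussTerm_nonneg (u : ℝ) (k : ℕ) : 0 ≤ u ^ 2 / ((4 + k) * ((8 + 2 * k) ^ 2 + u ^ 2)) := by
  positivity

/-- Termwise domination for `k ≥ 1` (`(8+2k)² ≥ 49`):  `98·u²/((8+2k)³(49+u²)) ≤ u²/((4+k)((8+2k)²+u²))`. -/
theorem gaussTerm_ge (u : ℝ) {k : ℕ} (hk : 1 ≤ k) :
    98 / ((8 + 2 * (k : ℝ)) ^ 3) * (u ^ 2 / (49 + u ^ 2)) ≤ u ^ 2 / ((4 + k) * ((8 + 2 * k) ^ 2 + u ^ 2)) := by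
  have hk' : (1 : ℝ) ≤ k := by exact_mod_cast hk
  have hc : (10 : ℝ) ≤ 8 + 2 * k := by linarith
  have hv : 0 ≤ u ^ 2 := sq_nonneg u
  rw [div_mul_div_comm, div_le_div_iff₀ (by positivity) (by positivity)]
  -- `98 u² (4+k)((8+2k)²+u²) ≤ u² (8+2k)³ (49+u²)`, i.e. `49 (8+2k) (...) ≤ ...`: reduce to `49 u² ≤ (8+2k)² u²`
  have key : 49 * ((8 + 2 * (k : ℝ)) ^ 2 + u ^ 2) ≤ (8 + 2 * (k : ℝ)) ^ 2 * (49 + u ^ 2) := by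
    nlinarith [mul_nonneg hv (by nlinarith : (0 : ℝ) ≤ (8 + 2 * (k : ℝ)) ^ 2 - 49)]
  have e : (98 : ℝ) * u ^ 2 * ((4 + k) * ((8 + 2 * k) ^ 2 + u ^ 2)) =
      u ^ 2 * (8 + 2 * k) * (49 * ((8 + 2 * (k : ℝ)) ^ 2 + u ^ 2)) := by ring
  rw [e]
  have h2 : u ^ 2 * (8 + 2 * (k : ℝ)) * ((8 + 2 * (k : ℝ)) ^ 2 * (49 + u ^ 2)) =
      u ^ 2 * ((8 + 2 * (k : ℝ)) ^ 3 * (49 + u ^ 2)) := by ring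
  rw [← h2]
  exact mul_le_mul_of_nonneg_left key (by positivity)

/-- The numerical fact `Σ_{k=1}^{18} 98/(8+2k)³ ≥ 2/7` (i.e. `Σ 7³/(8+2k)³ ≥ 1`; the sum is `1.0036…`). -/
theorem sum_weights_ge : (2 : ℝ) / 7 ≤ ∑ j ∈ Finset.range 18, 98 / ((8 + 2 * ((j + 1 : ℕ) : ℝ)) ^ 3) := by
  simp only [Finset.sum_range_succ, Finset.sum_range_zero, Nat.cast_add, Nat.cast_one, Nat.cast_ofNat,
    Nat.cast_zero]
  norm_num

/-- **The digamma gain dominates the rational loss** on `Re s = 8`: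
`u²/(4(64+u²)) + 2u²/(7(49+u²)) ≤ Re ψ(4+iu/2) − ψ(4)`. -/
theorem digamma_gain_four_line (u : ℝ) :
    u ^ 2 / (4 * (64 + u ^ 2)) + 2 * u ^ 2 / (7 * (49 + u ^ 2)) ≤
      (digamma (4 + ((u / 2 : ℝ) : ℂ) * I)).re - (digamma (4 : ℂ)).re := by
  have hsum := hasSum_re_digamma_four_line u
  have hpart := sum_le_hasSum (Finset.range 19) (fun k _ => gaussTerm_nonneg u k) hsum
  refine le_trans ?_ hpart
  rw [Finset.sum_range_succ']
  -- the `k = 0` term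
  have h0 : u ^ 2 / ((4 + ((0 : ℕ) : ℝ)) * ((8 + 2 * ((0 : ℕ) : ℝ)) ^ 2 + u ^ 2)) = u ^ 2 / (4 * (64 + u ^ 2)) := by
    norm_num
  -- the terms `k = 1, …, 18`
  have htail : 2 * u ^ 2 / (7 * (49 + u ^ 2)) ≤
      ∑ j ∈ Finset.range 18, u ^ 2 / ((4 + ((j + 1 : ℕ) : ℝ)) * ((8 + 2 * ((j + 1 : ℕ) : ℝ)) ^ 2 + u ^ 2)) := by
    have h1 : ∑ j ∈ Finset.range 18, 98 / ((8 + 2 * ((j + 1 : ℕ) : ℝ)) ^ 3) * (u ^ 2 / (49 + u ^ 2)) ≤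
        ∑ j ∈ Finset.range 18, u ^ 2 / ((4 + ((j + 1 : ℕ) : ℝ)) * ((8 + 2 * ((j + 1 : ℕ) : ℝ)) ^ 2 + u ^ 2)) :=
      Finset.sum_le_sum fun j _ => gaussTerm_ge u (by omega)
    rw [← Finset.sum_mul] at h1
    refine le_trans ?_ h1
    have hw := sum_weights_ge
    have hv : 0 ≤ u ^ 2 / (49 + u ^ 2) := by positivity
    calc 2 * u ^ 2 / (7 * (49 + u ^ 2)) = 2 / 7 * (u ^ 2 / (49 + u ^ 2)) := (div_mul_div_comm 2 7 _ _).symm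
      _ ≤ _ := mul_le_mul_of_nonneg_right hw hv
  rw [h0]
  linarith

/-! ## §3 The explicit formula on `Re s = 8` and the one-line minimum -/

/-- `Re(1/(8 + iu)) = 8/(64 + u²)`. -/
theorem re_one_div_eight_line (u : ℝ) : (1 / (((8 : ℝ) : ℂ) + (u : ℂ) * I)).re = 8 / (64 + u ^ 2) := by
  rw [one_div, Complex.inv_re, Complex.normSq_apply]
  simp
  ring

/-- `Re(1/(8 + iu − 1)) = 7/(49 + u²)`. -/
theorem re_one_div_seven_line (u : ℝ) : (1 / (((8 : ℝ) : ℂ) + (u : ℂ) * I - 1)).re = 7 / (49 + u ^ 2) := by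
  rw [one_div, Complex.inv_re, Complex.normSq_apply]
  simp
  ring

/-- **The explicit formula on `Re s = 8`** (RH-free):
`Re ξ'/ξ(8+iu) = 8/(64+u²) + 7/(49+u²) − ½log π + ½Re ψ(4+iu/2) − Re ΣΛ(n)n^{-8-iu}`. -/
theorem xiLogDerivRe_eight_eq (u : ℝ) :
    xiLogDerivRe 8 u = 8 / (64 + u ^ 2) + 7 / (49 + u ^ 2) +
      (-(Real.log Real.pi) / 2 + (digamma (4 + ((u / 2 : ℝ) : ℂ) * I)).re / 2) -
      (L ↗Λ (((8 : ℝ) : ℂ) + (u : ℂ) * I)).re := by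
  set s : ℂ := ((8 : ℝ) : ℂ) + (u : ℂ) * I with hs
  have hsre : 1 < s.re := by simp [hs]
  have hs2 : s / 2 = 4 + ((u / 2 : ℝ) : ℂ) * I := by
    rw [hs]; push_cast; ring
  rw [xiLogDerivRe_eq_logDeriv, logDeriv_riemannXi_eq_of_one_lt_re hsre]
  simp only [Complex.add_re, Complex.sub_re]
  rw [re_one_div_eight_line, re_one_div_seven_line, hs2]
  congr 2
  have e1 : (-(Real.log Real.pi : ℂ) / 2).re = -(Real.log Real.pi) / 2 := by
    rw [show (-(Real.log Real.pi : ℂ) / 2) = ((-(Real.log Real.pi) / 2 : ℝ) : ℂ) by push_cast; ring,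
      Complex.ofReal_re]
  have e2 : ((1 / 2 : ℂ) * digamma (4 + ((u / 2 : ℝ) : ℂ) * I)).re =
      (digamma (4 + ((u / 2 : ℝ) : ℂ) * I)).re / 2 := by
    rw [show (1 / 2 : ℂ) = ((1 / 2 : ℝ) : ℂ) by push_cast; ring, Complex.re_ofReal_mul]; ring
  rw [e1, e2]

/-- **The one-line minimum at `σ = 8`, PROVED** (RH-FREE, no zero information): `ξ'/ξ(8) ≤ Re ξ'/ξ(8 + iu)` for every
real `u` — the statement `XiLogDerivMinOnAxisAt 8` of the Defs file. -/
theorem xiLogDerivRe_eight_min (u : ℝ) : xiLogDerivRe 8 0 ≤ xiLogDerivRe 8 u := by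
  rw [xiLogDerivRe_eight_eq, xiLogDerivRe_eight_eq]
  have hL : (L ↗Λ (((8 : ℝ) : ℂ) + (u : ℂ) * I)).re ≤ (L ↗Λ (((8 : ℝ) : ℂ) + ((0 : ℝ) : ℂ) * I)).re := by
    have e : ((8 : ℝ) : ℂ) + ((0 : ℝ) : ℂ) * I = ((8 : ℝ) : ℂ) := by simp
    rw [e]
    exact re_LSeries_vonMangoldt_le (σ := 8) (by norm_num) (by simp)
  have hψ := digamma_gain_four_line u
  have e0 : (4 : ℂ) + (((0 : ℝ) / 2 : ℝ) : ℂ) * I = 4 := by simp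
  rw [e0]
  have h64 : (0 : ℝ) < 64 + u ^ 2 := by positivity
  have h49 : (0 : ℝ) < 49 + u ^ 2 := by positivity
  -- `1/8 − 8/(64+u²) = u²/(8(64+u²))`, `1/7 − 7/(49+u²) = u²/(7(49+u²))`
  have l1 : (8 : ℝ) / (64 + (0 : ℝ) ^ 2) - 8 / (64 + u ^ 2) = u ^ 2 / (8 * (64 + u ^ 2)) := by
    field_simp; ring
  have l2 : (7 : ℝ) / (49 + (0 : ℝ) ^ 2) - 7 / (49 + u ^ 2) = u ^ 2 / (7 * (49 + u ^ 2)) := by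
    field_simp; ring
  have m1 : u ^ 2 / (4 * (64 + u ^ 2)) = 2 * (u ^ 2 / (8 * (64 + u ^ 2))) := by
    field_simp; ring
  have m2 : 2 * u ^ 2 / (7 * (49 + u ^ 2)) = 2 * (u ^ 2 / (7 * (49 + u ^ 2))) := by ring
  linarith [l1, l2, hψ, hL, m1, m2]

/-! ## §4 The unconditional linear clean radius `c < (2/15)·ξ'/ξ(8)` -/

/-- **UNCONDITIONAL SHARPENED LINEAR CLEAN RADIUS** (RH-FREE): for every `c < ξ'/ξ(8)/(15/2) = (2/15)·ξ'/ξ(8)`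
(`= 0.042755…`) there is `θ₁` such that for all `θ ≥ θ₁` every window `0 ≤ t ≤ cθ` of `𝖪_θ` carries no eigenvalue `±1`.
(The window mechanism `linear_clean_radius_of_line_min` on the line `σ = 8`, whose minimum is `xiLogDerivRe_eight_min`.) -/
theorem linear_clean_radius_eight :
    ∀ c : ℝ, c < xiLogDerivRe 8 0 / (8 - 1 / 2) → ∃ θ₁ : ℝ, ∀ θ : ℝ, θ₁ ≤ θ → CleanUpTo θ (c * θ) :=
  linear_clean_radius_of_line_min (σ := 8) (by norm_num) xiLogDerivRe_eight_min

end Summit.RiemannHypothesis.RiemannHypothesis.Theorems.SuzukiSharpRadius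

end
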